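import Mathlib.Analysis.SpecialFunctions.Exp
import HarnessLib

/-!
# BalabanUVNodes ∕ N07 — [15] (162)∕(163)∕(166): THE ORDER OF CHOICES OF THE ONE-STEP IMPROVEMENT'S CONSTANTS — the collar `ρ` first (the far-site coefficient
# `θ = c·e^{−δ₁ρ}` beats every constant fixed after it), then `B₃ ≥ max{2L², 4C(ρ)}`, then the class ceiling `a₀` — exactly the smallness letters of this seat's closer
# `halvingStepTopCore_of_localLettersSplitCore` (p612069) and V19's floor `2L² ≤ B₃`

Cell `pub-ymgap`, width seat `pub-ymgap-dag-n07-w4` gen 3 (director-ym №197 ∕ HUMAN RULING D-0149); node N07 = [15] = T. Bałaban, *The variational problem and background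
fields in renormalization group method for lattice gauge theories*, Commun. Math. Phys. **102** (1985) 277–309 [Balaban1985Variational]; CLAIM-5 ∕ INTENT-6 of 2026-08-28 (bus
I.32369; n07-e's `K0-ROAD-CHAIN-CHECKLIST.md` §4∕§9 «HEAD arithmetic ○»).  NEW Theorems-side leaf (`--supports stmt-QuantumFields-20542 --as helper`); pure real arithmetic, theorems
only; imports Mathlib + `HarnessLib` only.  COUNT-NEUTRAL.

WHY.  Print closes the one-step improvement by CHOOSING constants in order: (162) *«B₃ = 72d³L³B₀ sup sup Σ …»* (the data coefficient of the `HB` chain DEFINES `B₃`), (163)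
*«B₃e^{−½δ₀R₁M₁} ≦ ½»* (the far-site coefficient is made small by the COLLAR `R₁M₁`, exponentially), (166) *«We take a largest absolute number a₅ such that … B₀(C₄ + 4C₂)(36dL²B₁R₁M₁)²a₅
≦ ⅛»* (the quadratic terms are beaten by the class ceiling), and under road R0′ the shear's `24t²` (n07-w8's (r2)) and the factor `D² ≤ (d·M_top)²` of (166♭) (n07-e ∕ n07-w7) join the
quadratic slot.  This seat's closer `halvingStepTopCore_of_localLettersSplitCore` (p612069) asks these as the letters `0 ≤ B₃`, `4C ≤ B₃`, `16θ ≤ 1`, `0 ≤ Q`, `0 ≤ κ`, `(16Q + 1024κ²)·a₀ ≤ 1`,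
`32κ·a₀ ≤ 1`, `2a₀ ≤ 1`, and V19's stub 1 adds the floor `2L² ≤ B₃`.  The rows' coefficients depend on the collar: `C = C(ρ)` (through `M′ = sideP(ρ)`), `Q = Q(ρ)`, `κ = κ(ρ)` may GROW with
`ρ`, while `θ(ρ) = c·e^{−δ₁ρ}` decays.  THIS FILE proves the choices are consistent in that order, for ARBITRARY nonnegative coefficient functions of `ρ` (robust to the letters the
rows will finally carry): pick `ρ ≥ ρ₀` with `16·c·e^{−δ₁ρ} ≤ 1` (§1), then `B₃ := max{2L², 4C(ρ), 0}` (§2), then `a₀ := (2 + 16Q(ρ) + 1024κ(ρ)² + 32κ(ρ))⁻¹` (§2), assembled in §3.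

CONTENTS.  §1 `exists_nat_mul_exp_neg_le` (exponential decay beats a constant, over `ℕ`).  §2 `exists_a0_budget`, `exists_B3_budget`.  §3 ★★ `exists_halvingBudget`.

HONEST FRAMING: count-neutral freshman real analysis (`1 + x ≤ eˣ`); NO estimate of Bałaban's is proved; it fixes only the ORDER of the choices (162)∕(163)∕(166); the coefficient
functions are ARBITRARY inputs; tokens ∕ `stub_prop8StepCoP13` ∕ K0⁷ ∕ K1⁷ NOT closed; N07 NOT discharged; counts unmoved (28∕28 · 5∕27); one finite 𝕋⁴ programme at fixed ε — R4 closes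
the conditional finite-𝕋⁴ rung `BalabanLadder.UV` ONLY; the YM mass gap (Clay) is NOT proved by any of this; nothing continuum ∕ ℝ⁴ ∕ OS.  No `def`, no `instance`, no `notation`, no `sorry`.
-/

namespace Summit.QuantumFields.YangMills.BalabanUVNodes.N07HalvingBudgetConstants

/-! ## §1  The collar first: exponential decay beats any fixed constant -/

/-- **(163) «B₃e^{−½δ₀R₁M₁} ≦ ½» — THE COLLAR IS CHOSEN FIRST**: for `δ₁ > 0`, `η > 0`, any `c` and any floor `ρ₀`, some `ρ ≥ ρ₀` has `c·e^{−δ₁ρ} ≤ η`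
(`e^{−x} ≤ (1 + x)⁻¹` from `1 + x ≤ eˣ`; take `ρ ≥ c ∕ (η·δ₁)`). [cite: Balaban1985Variational, (163) p.304] -/
theorem exists_nat_mul_exp_neg_le {δ₁ η : ℝ} (hδ₁ : 0 < δ₁) (hη : 0 < η) (c : ℝ) (ρ₀ : ℕ) :
    ∃ ρ : ℕ, ρ₀ ≤ ρ ∧ c * Real.exp (-(δ₁ * ρ)) ≤ η := by
  obtain ⟨N, hN⟩ := exists_nat_ge (c / (η * δ₁))
  refine ⟨max ρ₀ N, le_max_left _ _, ?_⟩
  set ρ : ℕ := max ρ₀ N with hρ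
  have hρN : (N : ℝ) ≤ ρ := by exact_mod_cast le_max_right ρ₀ N
  have hx : 0 ≤ δ₁ * (ρ : ℝ) := mul_nonneg hδ₁.le (Nat.cast_nonneg ρ)
  have hexp : Real.exp (-(δ₁ * ρ)) ≤ 1 / (1 + δ₁ * ρ) := by
    rw [Real.exp_neg, one_div]
    exact inv_anti₀ (by linarith) (by linarith [Real.add_one_le_exp (δ₁ * ρ)])
  have hpos : 0 < 1 + δ₁ * (ρ : ℝ) := by linarith
  by_cases hc : c ≤ 0
  · calc c * Real.exp (-(δ₁ * ρ)) ≤ 0 := mul_nonpos_of_nonpos_of_nonneg hc (Real.exp_nonneg _)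
      _ ≤ η := hη.le
  · have hc : 0 < c := lt_of_not_ge hc
    have hcη : c ≤ η * (1 + δ₁ * ρ) := by
      have h1 : c / (η * δ₁) ≤ ρ := hN.trans hρN
      rw [div_le_iff₀ (mul_pos hη hδ₁)] at h1
      nlinarith
    calc c * Real.exp (-(δ₁ * ρ)) ≤ c * (1 / (1 + δ₁ * ρ)) := mul_le_mul_of_nonneg_left hexp hc.le
      _ = c / (1 + δ₁ * ρ) := by rw [mul_one_div]
      _ ≤ η := by rw [div_le_iff₀ hpos]; exact hcη

/-! ## §2  Then `B₃`, then the class ceiling `a₀` -/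

/-- **(166) «WE TAKE A LARGEST ABSOLUTE NUMBER a₅ …»**: for `Q, κ ≥ 0` the ceiling `a₀ := (2 + 16Q + 1024κ² + 32κ)⁻¹` satisfies `0 < a₀`, `2a₀ ≤ 1`, `(16Q + 1024κ²)·a₀ ≤ 1`, `32κ·a₀ ≤ 1`
— the last three smallness letters of `halvingStepTopCore_of_localLettersSplitCore`. [cite: Balaban1985Variational, (166) p.304] -/
theorem exists_a0_budget {Q κ : ℝ} (hQ : 0 ≤ Q) (hκ : 0 ≤ κ) :
    ∃ a₀ : ℝ, 0 < a₀ ∧ 2 * a₀ ≤ 1 ∧ (16 * Q + 1024 * κ ^ 2) * a₀ ≤ 1 ∧ 32 * κ * a₀ ≤ 1 := by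
  set S : ℝ := 2 + 16 * Q + 1024 * κ ^ 2 + 32 * κ with hS
  have hSpos : 0 < S := by rw [hS]; positivity
  refine ⟨S⁻¹, inv_pos.mpr hSpos, ?_, ?_, ?_⟩
  · rw [← div_eq_mul_inv, div_le_one hSpos, hS]; nlinarith [sq_nonneg κ]
  · rw [← div_eq_mul_inv, div_le_one hSpos, hS]; nlinarith
  · rw [← div_eq_mul_inv, div_le_one hSpos, hS]; nlinarith [sq_nonneg κ]

/-- **(162) «B₃ = …» WITH V19's FLOOR**: for any `L`, `C` the constant `B₃ := max{2L², 4C, 0}` satisfies `0 ≤ B₃`, `2L² ≤ B₃`, `4C ≤ B₃`. [cite: Balaban1985Variational, (162) p.303] -/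
theorem exists_B3_budget (L C : ℝ) : ∃ B₃ : ℝ, 0 ≤ B₃ ∧ 2 * L ^ 2 ≤ B₃ ∧ 4 * C ≤ B₃ :=
  ⟨max (max (2 * L ^ 2) (4 * C)) 0, le_max_right _ _, (le_max_left _ _).trans (le_max_left _ _),
    (le_max_right _ _).trans (le_max_left _ _)⟩

/-! ## §3  ★★ The order of choices, assembled -/

/-- ★★ **THE CONSTANTS OF THE ONE-STEP IMPROVEMENT CAN BE CHOSEN IN PRINT'S ORDER — (163) the collar, (162) `B₃`, (166)∕(166♭) the ceiling**: let `δ₁ > 0` and `c` be the rate and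
prefactor of the far-site coefficient `θ(ρ) = c·e^{−δ₁ρ}` (the `HB` doors' `8CB₃e^{−δ₁ρ} ≤ θ`), and let the data, quadratic and shear coefficients be ARBITRARY nonnegative functions
`Cof Qof κof : ℕ → ℝ` of the collar `ρ` (through `sideP(ρ)`, `D²`, `σ♮`, `B₀(8σ² + 20σv)`, … — whatever the rows carry).  Then for every floor `ρ₀` there are `ρ ≥ ρ₀`, `B₃`, `a₀` with
ALL the smallness letters of `halvingStepTopCore_of_localLettersSplitCore` (p612069) at `θ := c·e^{−δ₁ρ}`, `C := Cof ρ`, `Q := Qof ρ`, `κ := κof ρ` — `16θ ≤ 1`, `0 ≤ B₃`, `4C ≤ B₃`, `0 < a₀`,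
`2a₀ ≤ 1`, `(16Q + 1024κ²)·a₀ ≤ 1`, `32κ·a₀ ≤ 1` — plus V19's floor `2L² ≤ B₃`.  (`0 ≤ Q`, `0 ≤ κ` are the inputs.)  NO estimate: only the order of the choices.
[cite: Balaban1985Variational, (162)–(163) pp.303–304, (166)–(167) p.304] -/
theorem exists_halvingBudget {δ₁ : ℝ} (hδ₁ : 0 < δ₁) (L c : ℝ) {Cof Qof κof : ℕ → ℝ} (hQ : ∀ ρ, 0 ≤ Qof ρ) (hκ : ∀ ρ, 0 ≤ κof ρ) (ρ₀ : ℕ) :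
    ∃ ρ : ℕ, ρ₀ ≤ ρ ∧ ∃ B₃ a₀ : ℝ,
      16 * (c * Real.exp (-(δ₁ * ρ))) ≤ 1 ∧ 0 ≤ B₃ ∧ 2 * L ^ 2 ≤ B₃ ∧ 4 * Cof ρ ≤ B₃ ∧
      0 < a₀ ∧ 2 * a₀ ≤ 1 ∧ (16 * Qof ρ + 1024 * κof ρ ^ 2) * a₀ ≤ 1 ∧ 32 * κof ρ * a₀ ≤ 1 := by
  obtain ⟨ρ, hρ₀, hθ⟩ := exists_nat_mul_exp_neg_le hδ₁ (by norm_num : (0 : ℝ) < 1 / 16) c ρ₀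
  obtain ⟨B₃, hB₃0, hB₃L, hB₃C⟩ := exists_B3_budget L (Cof ρ)
  obtain ⟨a₀, ha₀, ha₂, haQ, haκ⟩ := exists_a0_budget (hQ ρ) (hκ ρ)
  exact ⟨ρ, hρ₀, B₃, a₀, by linarith, hB₃0, hB₃L, hB₃C, ha₀, ha₂, haQ, haκ⟩

end Summit.QuantumFields.YangMills.BalabanUVNodes.N07HalvingBudgetConstants
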